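/-
Copyright (c) 2026. All rights reserved.
Released under Apache 2.0 license as described in the file LICENSE.
Authors: abc-iut cell, prover seat abc-iut-w5-d138 (wave 5, gen 8).
-/
import Literature.IUT.LogThetaLattice.LogLinkIteratesWildPrime
import HarnessLib

/-!
# Two successive `p`-adic logarithms of units at `e = p`, `f = 1` (`p` odd), I: the congruences

Proof-only companion (theorems, no definitions) of abc-iut-S1's `LocalUnitLog.lean` (`unitLog = log_p` on
`𝒪_K^×`), abc-iut-w5-d017's `UnitLogRamificationCriterion.lean` (`p` odd: `log_p(𝒪_K^×)` meets `𝒪_K^×` iff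
`p ∣ e(K/ℚ_p)` — the DEPTH-`2` question) and abc-iut-w5-d138's `UnitLogWildPrime.lean` /
`LogLinkIteratesWildPrime.lean` (`πᵖ = p ⇒` every iterate `log_p^{[n]}(1 + π)` is a unit).  Together with
`UnitLogDepthThreeDichotomy.lean` it answers the NEXT question — can a unit survive TWO logarithms,
`‖log_p u‖ = ‖log_p(log_p u)‖ = 1`? — in the first wildly ramified case; the answer is NOT a function of
`(p, e, f)`.

Setting (elementary form of "`[K : ℚ_p] = p`, totally ramified", `p` odd): `K` a complete ultrametric normed
`ℚ_p`-algebra field, `π ∈ K` with `‖π‖ᵖ = p⁻¹`, the GAP hypothesis `‖x‖ < 1 ⇒ ‖x‖ ≤ ‖π‖` (`e = p`: `π` is a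
norm uniformizer) and the FROBENIUS hypothesis `‖t‖ ≤ 1 ⇒ ‖tᵖ − t‖ < 1` (`f = 1`: the residue field is
`𝔽_p`).  Put `v := πᵖ/p ∈ 𝒪_K^×`, `w := v + π`, `c := (p − 1)⁻¹`.  For a unit `u` the power `u^{p−1}` is a
principal unit (`f = 1`), `log_p u = c · L(u^{p−1})` (`unitLog_eq_c_mul`), and with `u^{p−1} = 1 + πt`,
`‖t‖ ≤ 1`:

* `norm_logSeries_le_of_le_sq` — `‖L(y)‖ ≤ ‖1 − y‖` on `‖1 − y‖ ≤ ‖π‖²` (abc-iut-S1's Lipschitz bound; the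
  radius condition `p^{−2/p}·p^{1/(p−1)} ≤ 1` is `sq_mul_rpow_le_one`); `norm_logSeries_one_add_sub_le_sq` —
  **`L(1 + x) ≡ x + xᵖ/p (mod π²)`** for `‖x‖ ≤ ‖π‖` (every other term is `O(π²)`; `p ≠ 2`);
* `norm_unitLog_le_sq` — `‖u^{p−1} − 1‖ ≤ ‖π‖² ⇒ ‖log_p u‖ ≤ ‖π‖²`; hence a unit with a UNIT logarithm has
  `‖u^{p−1} − 1‖ = ‖π‖`, i.e. is NOT congruent to a Teichmüller representative mod `π²`
  (`norm_pow_sub_one_eq_of_norm_unitLog_eq_one`), and conversely (`norm_unitLog_eq_one_of_norm_pow_sub_one_eq`: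
  DEPTH `2` is inhabited, as `p ∣ e = p`);
* **`norm_unitLog_sub_main_le_sq`** — the KEY CONGRUENCE **`log_p u ≡ c · tᵖ · w (mod π²)`**
  (`x + xᵖ/p = πt + tᵖv` and `πt ≡ πtᵖ` by Frobenius).

Classical `p`-adic analysis (Neukirch, *Algebraic Number Theory*, Ch. II (5.5)); nothing here is disputed
mathematics; no IUT statement is asserted; nothing bears on [IUTchIII] Cor. 3.12.
-/

noncomputable section

open Metric Set Finset
open scoped NormedField

namespace Literature.IUT.LogVolume

namespace DepthThree

open Literature.IUT.LogThetaLattice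

variable {p : ℕ} [hp : Fact p.Prime]
variable {K : Type*} [NontriviallyNormedField K] [instK : NormedAlgebra ℚ_[p] K] [IsUltrametricDist K]
variable {π : K}

/-! ### §1. `‖π‖ᵖ = p⁻¹` -/

/-- `p ∤ p − 1`. [cite: NeukirchANT1999, Ch. II (5.5)] -/
theorem not_prime_dvd_sub_one : ¬ p ∣ p - 1 := by
  intro h
  have h2 := hp.out.two_le
  have := Nat.le_of_dvd (by omega) h
  omega

omit instK [IsUltrametricDist K] in
/-- `‖π‖ < 1`. [cite: NeukirchANT1999, Ch. II (5.5)] -/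
theorem norm_pi_lt_one (hπ : ‖π‖ ^ p = (p : ℝ)⁻¹) : ‖π‖ < 1 := by
  have hp1 : (1 : ℝ) < p := by exact_mod_cast hp.out.one_lt
  have hlt : ‖π‖ ^ p < 1 := by rw [hπ]; exact inv_lt_one_of_one_lt₀ hp1
  exact lt_of_pow_lt_pow_left₀ p zero_le_one (by rwa [one_pow])

omit instK [IsUltrametricDist K] in
/-- `0 < ‖π‖`. [cite: NeukirchANT1999, Ch. II (5.5)] -/
theorem norm_pi_pos (hπ : ‖π‖ ^ p = (p : ℝ)⁻¹) : 0 < ‖π‖ := by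
  have hp0 : (0 : ℝ) < p := by exact_mod_cast hp.out.pos
  rcases (norm_nonneg π).eq_or_lt with h | h
  · exfalso
    rw [← h, zero_pow hp.out.ne_zero] at hπ
    exact (inv_pos.mpr hp0).ne hπ
  · exact h

omit instK [IsUltrametricDist K] in
/-- `π ≠ 0`. [cite: NeukirchANT1999, Ch. II (5.5)] -/
theorem pi_ne_zero (hπ : ‖π‖ ^ p = (p : ℝ)⁻¹) : π ≠ 0 :=
  norm_pos_iff.mp (norm_pi_pos hπ)

omit [IsUltrametricDist K] in
/-- `‖p‖ = ‖π‖ᵖ ≤ ‖π‖²` (`p ≥ 2`). [cite: NeukirchANT1999, Ch. II (5.5)] -/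
theorem norm_prime_le_sq (hπ : ‖π‖ ^ p = (p : ℝ)⁻¹) : ‖(p : K)‖ ≤ ‖π‖ ^ 2 := by
  rw [norm_prime p K, ← hπ]
  exact pow_le_pow_of_le_one (norm_nonneg _) (norm_pi_lt_one hπ).le hp.out.two_le

omit [IsUltrametricDist K] in
/-- `v := πᵖ/p` is a unit: `‖πᵖ/p‖ = 1`. [cite: NeukirchANT1999, Ch. II (5.5)] -/
theorem norm_v_eq_one (hπ : ‖π‖ ^ p = (p : ℝ)⁻¹) : ‖π ^ p / (p : K)‖ = 1 := by
  have hp0 : (p : ℝ) ≠ 0 := by exact_mod_cast hp.out.ne_zero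
  rw [norm_div, norm_pow, hπ, norm_prime p K, div_self (inv_ne_zero hp0)]

/-- `w := πᵖ/p + π` is a unit: `‖πᵖ/p + π‖ = 1`. [cite: NeukirchANT1999, Ch. II (5.5)] -/
theorem norm_w_eq_one (hπ : ‖π‖ ^ p = (p : ℝ)⁻¹) : ‖π ^ p / (p : K) + π‖ = 1 := by
  have h1 := norm_v_eq_one hπ
  have hlt : ‖π‖ < ‖π ^ p / (p : K)‖ := by rw [h1]; exact norm_pi_lt_one hπ
  rw [IsUltrametricDist.norm_add_eq_max_of_norm_ne_norm (ne_of_gt hlt), max_eq_left hlt.le, h1]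

/-! ### §2. The gap hypothesis (`π` generates the value group near `1`) -/

omit instK [IsUltrametricDist K] in
/-- Below `‖π‖` the next norm is `≤ ‖π‖²`. [cite: NeukirchANT1999, Ch. II (5.5)] -/
theorem norm_le_sq_of_norm_lt (hπ : ‖π‖ ^ p = (p : ℝ)⁻¹) (hgap : ∀ x : K, ‖x‖ < 1 → ‖x‖ ≤ ‖π‖)
    {x : K} (hx : ‖x‖ < ‖π‖) : ‖x‖ ≤ ‖π‖ ^ 2 := by
  have h0 : 0 < ‖π‖ := norm_pi_pos hπ
  have h1 : ‖x / π‖ < 1 := by rwa [norm_div, div_lt_one h0]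
  have h2 := hgap _ h1
  rw [norm_div, div_le_iff₀ h0] at h2
  rwa [sq]

omit instK [IsUltrametricDist K] in
/-- TRICHOTOMY: an element of norm `< 1` has norm `‖π‖` or `≤ ‖π‖²`. [cite: NeukirchANT1999, Ch. II (5.5)] -/
theorem norm_eq_or_le_sq (hπ : ‖π‖ ^ p = (p : ℝ)⁻¹) (hgap : ∀ x : K, ‖x‖ < 1 → ‖x‖ ≤ ‖π‖)
    {x : K} (hx : ‖x‖ < 1) : ‖x‖ = ‖π‖ ∨ ‖x‖ ≤ ‖π‖ ^ 2 := by
  rcases (hgap x hx).eq_or_lt with h | h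
  · exact Or.inl h
  · exact Or.inr (norm_le_sq_of_norm_lt hπ hgap h)

omit instK [IsUltrametricDist K] in
/-- `‖π‖² < ‖π‖`. [cite: NeukirchANT1999, Ch. II (5.5)] -/
theorem sq_lt_norm_pi (hπ : ‖π‖ ^ p = (p : ℝ)⁻¹) : ‖π‖ ^ 2 < ‖π‖ := by
  have h0 := norm_pi_pos hπ
  have h1 := norm_pi_lt_one hπ
  calc ‖π‖ ^ 2 = ‖π‖ * ‖π‖ := sq _
    _ < 1 * ‖π‖ := by gcongr
    _ = ‖π‖ := one_mul _

/-! ### §3. The logarithmic series on `‖1 − y‖ ≤ ‖π‖²` and on `‖1 − y‖ ≤ ‖π‖` -/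

omit instK [IsUltrametricDist K] in
/-- `‖π‖² · p^{1/(p−1)} ≤ 1` (i.e. `p^{−2/p + 1/(p−1)} ≤ 1`, `p ≥ 2`): the ball of radius `‖π‖²` lies in the
Lipschitz range of the logarithmic series. [cite: NeukirchANT1999, Ch. II (5.5)] -/
theorem sq_mul_rpow_le_one (hπ : ‖π‖ ^ p = (p : ℝ)⁻¹) :
    ‖π‖ ^ 2 * (p : ℝ) ^ (1 / ((p : ℝ) - 1)) ≤ 1 := by
  obtain ⟨n, hn⟩ : ∃ n : ℕ, p = n + 1 := ⟨p - 1, (Nat.sub_add_cancel hp.out.one_le).symm⟩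
  have hn1 : 1 ≤ n := by have := hp.out.two_le; omega
  have hp0 : (0 : ℝ) < p := by exact_mod_cast hp.out.pos
  have hp1 : (1 : ℝ) ≤ p := by exact_mod_cast hp.out.one_le
  set q : ℝ := (p : ℝ) ^ (1 / ((p : ℝ) - 1)) with hq
  have hq0 : 0 ≤ q := Real.rpow_nonneg hp0.le _
  have hpn : (p : ℝ) - 1 = n := by rw [hn]; push_cast; ring
  have hn0 : (n : ℝ) ≠ 0 := by exact_mod_cast (by omega : n ≠ 0)
  have hqn : q ^ n = p := by
    rw [hq, ← Real.rpow_natCast, ← Real.rpow_mul hp0.le, hpn, one_div, inv_mul_cancel₀ hn0,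
      Real.rpow_one]
  have hx0 : 0 ≤ ‖π‖ ^ 2 * q := mul_nonneg (sq_nonneg _) hq0
  have hN : (n + 1) * n ≠ 0 := by positivity
  rw [← pow_le_one_iff_of_nonneg hx0 hN]
  have hrw : (‖π‖ ^ 2 * q) ^ ((n + 1) * n) = (‖π‖ ^ (n + 1)) ^ (2 * n) * (q ^ n) ^ (n + 1) := by ring
  rw [hrw, ← hn, hπ, hqn, inv_pow]
  rw [inv_mul_le_iff₀ (pow_pos hp0 _), mul_one]
  exact pow_le_pow_right₀ hp1 (by omega)

variable [CompleteSpace K]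

/-- **`‖L(y)‖ ≤ ‖1 − y‖` for `‖1 − y‖ ≤ ‖π‖²`** (abc-iut-S1's Lipschitz bound `norm_logSeries_le_norm`).
[cite: NeukirchANT1999, Ch. II (5.5)] -/
theorem norm_logSeries_le_of_le_sq (hπ : ‖π‖ ^ p = (p : ℝ)⁻¹) {y : K} (hy : ‖1 - y‖ ≤ ‖π‖ ^ 2) :
    ‖logSeries y‖ ≤ ‖1 - y‖ :=
  norm_logSeries_le_norm p K (sq_mul_rpow_le_one hπ) hy

omit [IsUltrametricDist K] [CompleteSpace K] in
/-- The terms of `L(1 + x)` of index `∉ {1, p}` are `O(π²)` when `‖x‖ ≤ ‖π‖` (`p ≠ 2`; abc-iut-w5-d138 gen 4's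
`norm_logTerm_le_sq_of_ne` with the hypothesis `πᵖ = p` weakened to `‖π‖ᵖ = p⁻¹`).
[cite: NeukirchANT1999, Ch. II (5.5)] -/
theorem norm_logTerm_le_sq_of_ne (hp2 : p ≠ 2) (hπ : ‖π‖ ^ p = (p : ℝ)⁻¹) {x : K} (hxn : ‖x‖ ≤ ‖π‖)
    {n : ℕ} (hn1 : n + 1 ≠ 1) (hnp : n + 1 ≠ p) :
    ‖-((1 - (1 + x)) ^ (n + 1)) / (n + 1 : K)‖ ≤ ‖π‖ ^ 2 := by
  rw [WildPrime.norm_logTerm_eq p x n]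
  have hπ0 : 0 ≤ ‖π‖ := norm_nonneg π
  have hπ1 : ‖π‖ ≤ 1 := (norm_pi_lt_one hπ).le
  have hp1 : (1 : ℝ) ≤ p := by exact_mod_cast hp.out.one_le
  have hp0 : (0 : ℝ) < p := by exact_mod_cast hp.out.pos
  have hxp : ‖x‖ ^ (n + 1) ≤ ‖π‖ ^ (n + 1) := pow_le_pow_left₀ (norm_nonneg _) hxn _
  refine (mul_le_mul_of_nonneg_right hxp (by positivity)).trans ?_
  by_cases hdvd : p ∣ n + 1
  · obtain ⟨m, hm⟩ := hdvd
    have hm0 : m ≠ 0 := by rintro rfl; simp at hm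
    have hm1 : m ≠ 1 := by rintro rfl; rw [mul_one] at hm; exact hnp hm
    have hm2 : 2 ≤ m := by omega
    have hval : padicValNat p (n + 1) = padicValNat p m + 1 := by
      rw [hm, padicValNat.mul hp.out.ne_zero hm0, padicValNat_self, add_comm]
    have hkey := WildPrime.padicValNat_add_two_le hp2 hm2
    rw [hval, hm, pow_mul, hπ, inv_pow]
    calc ((p : ℝ) ^ m)⁻¹ * (p : ℝ) ^ (padicValNat p m + 1)
        ≤ ((p : ℝ) ^ m)⁻¹ * (p : ℝ) ^ (m - 1) :=
          mul_le_mul_of_nonneg_left (pow_le_pow_right₀ hp1 (by omega)) (by positivity)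
      _ = (p : ℝ)⁻¹ := by
          have hpm : (p : ℝ) ^ m = (p : ℝ) ^ (m - 1) * p := by
            rw [← pow_succ, Nat.sub_add_cancel (by omega : 1 ≤ m)]
          rw [hpm, mul_inv, mul_assoc, mul_comm (p : ℝ)⁻¹, ← mul_assoc,
            inv_mul_cancel₀ (pow_ne_zero _ hp0.ne'), one_mul]
      _ = ‖π‖ ^ p := hπ.symm
      _ ≤ ‖π‖ ^ 2 := pow_le_pow_of_le_one hπ0 hπ1 hp.out.two_le
  · rw [padicValNat.eq_zero_of_not_dvd hdvd, pow_zero, mul_one]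
    exact pow_le_pow_of_le_one hπ0 hπ1 (by omega)

/-- **`L(1 + x) ≡ x + xᵖ/p (mod π²)`** for `‖x‖ ≤ ‖π‖`, `p ≠ 2`: `‖L(1 + x) − (x + xᵖ/p)‖ ≤ ‖π‖²` (puncture
the series at the indices `1` and `p`; every remaining term is `O(π²)`). [cite: NeukirchANT1999, Ch. II (5.5)] -/
theorem norm_logSeries_one_add_sub_le_sq (hp2 : p ≠ 2) (hπ : ‖π‖ ^ p = (p : ℝ)⁻¹) {x : K}
    (hxn : ‖x‖ ≤ ‖π‖) : ‖logSeries (1 + x) - (x + x ^ p / (p : K))‖ ≤ ‖π‖ ^ 2 := by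
  classical
  have hodd : Odd p := hp.out.odd_of_ne_two hp2
  have hprinc : ‖(1 : K) - (1 + x)‖ < 1 := by
    rw [show (1 : K) - (1 + x) = -x by ring, norm_neg]
    exact hxn.trans_lt (norm_pi_lt_one hπ)
  set f : ℕ → K := fun n ↦ -((1 - (1 + x)) ^ (n + 1)) / (n + 1 : K) with hf
  have hsum : HasSum f (logSeries (1 + x)) := hasSum_logSeries p hprinc
  have hf0 : f 0 = x := by
    simp only [hf, Nat.cast_zero, zero_add, pow_one, div_one]
    ring
  have hfp : f (p - 1) = x ^ p / (p : K) := by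
    simp only [hf]
    rw [show ((p - 1 : ℕ) : K) + 1 = (p : K) by
          norm_cast; rw [Nat.sub_add_cancel hp.out.one_le],
      Nat.sub_add_cancel hp.out.one_le, show (1 : K) - (1 + x) = -x by ring, hodd.neg_pow, neg_neg]
  have h1 : HasSum (fun n ↦ if n = 0 then 0 else f n) (logSeries (1 + x) - f 0) :=
    hasSum_ite_sub_hasSum hsum 0
  have h2 : HasSum (fun n ↦ if n = p - 1 then 0 else (if n = 0 then 0 else f n))
      (logSeries (1 + x) - f 0 - f (p - 1)) := by
    have := hasSum_ite_sub_hasSum h1 (p - 1)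
    rwa [if_neg (by have := hp.out.two_le; omega : p - 1 ≠ 0)] at this
  have hrest : ‖logSeries (1 + x) - f 0 - f (p - 1)‖ ≤ ‖π‖ ^ 2 := by
    rw [← h2.tsum_eq]
    refine IsUltrametricDist.norm_tsum_le_of_forall_le_of_nonneg (sq_nonneg _) fun n ↦ ?_
    by_cases hnp : n = p - 1
    · rw [if_pos hnp, norm_zero]; exact sq_nonneg _
    rw [if_neg hnp]
    by_cases hn0 : n = 0
    · rw [if_pos hn0, norm_zero]; exact sq_nonneg _
    rw [if_neg hn0, hf]
    exact norm_logTerm_le_sq_of_ne hp2 hπ hxn (by omega) (by have := hp.out.two_le; omega)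
  rw [show logSeries (1 + x) - (x + x ^ p / (p : K)) = logSeries (1 + x) - f 0 - f (p - 1) by
    rw [hf0, hfp]; ring]
  exact hrest

/-! ### §4. The Frobenius hypothesis (`f = 1`) and the first logarithm -/

omit hp instK [IsUltrametricDist K] [CompleteSpace K] in
/-- `‖tᵖ − t‖ ≤ ‖π‖` for `‖t‖ ≤ 1` (Frobenius + gap). [cite: NeukirchANT1999, Ch. II (5.5)] -/
theorem norm_frob_le (hgap : ∀ x : K, ‖x‖ < 1 → ‖x‖ ≤ ‖π‖)
    (hfrob : ∀ t : K, ‖t‖ ≤ 1 → ‖t ^ p - t‖ < 1) {t : K} (ht : ‖t‖ ≤ 1) : ‖t ^ p - t‖ ≤ ‖π‖ :=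
  hgap _ (hfrob t ht)

omit instK [IsUltrametricDist K] [CompleteSpace K] in
/-- For a unit `u`, `u^{p−1}` is a principal unit: `‖u^{p−1} − 1‖ < 1` (`uᵖ − u = u·(u^{p−1} − 1)`).
[cite: NeukirchANT1999, Ch. II (5.5)] -/
theorem norm_pow_sub_one_lt_one (hfrob : ∀ t : K, ‖t‖ ≤ 1 → ‖t ^ p - t‖ < 1) {u : K} (hu : ‖u‖ = 1) :
    ‖u ^ (p - 1) - 1‖ < 1 := by
  have h := hfrob u hu.le
  have hsplit : u ^ p - u = u * (u ^ (p - 1) - 1) := by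
    rw [mul_sub, mul_one, ← pow_succ', Nat.sub_add_cancel hp.out.one_le]
  rwa [hsplit, norm_mul, hu, one_mul] at h

omit instK [IsUltrametricDist K] [CompleteSpace K] in
/-- … hence `‖u^{p−1} − 1‖ ≤ ‖π‖` for every unit `u`. [cite: NeukirchANT1999, Ch. II (5.5)] -/
theorem norm_pow_sub_one_le (hgap : ∀ x : K, ‖x‖ < 1 → ‖x‖ ≤ ‖π‖)
    (hfrob : ∀ t : K, ‖t‖ ≤ 1 → ‖t ^ p - t‖ < 1) {u : K} (hu : ‖u‖ = 1) : ‖u ^ (p - 1) - 1‖ ≤ ‖π‖ :=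
  hgap _ (norm_pow_sub_one_lt_one hfrob hu)

omit [IsUltrametricDist K] [CompleteSpace K] in
/-- `‖(p − 1)⁻¹‖ = 1` in `K`. [cite: NeukirchANT1999, Ch. II (5.5)] -/
theorem norm_c_eq_one : ‖(((p - 1 : ℕ) : K))⁻¹‖ = 1 := by
  have hnd : ¬ p ∣ p - 1 := not_prime_dvd_sub_one
  rw [norm_inv, norm_natCast_eq_one_of_not_dvd p hnd, inv_one]

omit [IsUltrametricDist K] [CompleteSpace K] in
/-- `c := (p − 1)⁻¹ ≡ −1 (mod p)`: `‖c + 1‖ = ‖p‖` (`c + 1 = c·p`). [cite: NeukirchANT1999, Ch. II (5.5)] -/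
theorem norm_c_add_one : ‖(((p - 1 : ℕ) : K))⁻¹ + 1‖ = ‖(p : K)‖ := by
  have hnd : ¬ p ∣ p - 1 := not_prime_dvd_sub_one
  have h1 : ‖((p - 1 : ℕ) : K)‖ = 1 := norm_natCast_eq_one_of_not_dvd p hnd
  have h0 : ((p - 1 : ℕ) : K) ≠ 0 := norm_pos_iff.mp (by rw [h1]; exact one_pos)
  have hp' : (((p - 1 : ℕ) : K)) + 1 = (p : K) := by
    norm_cast; rw [Nat.sub_add_cancel hp.out.one_le]
  have : (((p - 1 : ℕ) : K))⁻¹ + 1 = (((p - 1 : ℕ) : K))⁻¹ * (p : K) := by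
    rw [← hp', mul_add, inv_mul_cancel₀ h0, mul_one, add_comm]
  rw [this, norm_mul, norm_inv, h1, inv_one, one_mul]

/-- **`log_p u = (p − 1)⁻¹ · L(u^{p−1})`** for a unit `u` (abc-iut-S1's independence of the exponent).
[cite: NeukirchANT1999, Ch. II (5.5)] -/
theorem unitLog_eq_c_mul (hfrob : ∀ t : K, ‖t‖ ≤ 1 → ‖t ^ p - t‖ < 1) {u : K} (hu : ‖u‖ = 1) :
    unitLog u = (((p - 1 : ℕ) : K))⁻¹ * logSeries (u ^ (p - 1)) := by
  have hP : IsPrincipal (u ^ (p - 1)) := by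
    show ‖1 - u ^ (p - 1)‖ < 1
    rw [norm_sub_rev]; exact norm_pow_sub_one_lt_one hfrob hu
  exact unitLog_eq_inv_mul_logSeries p (by have := hp.out.two_le; omega) hP

/-- **`‖u^{p−1} − 1‖ ≤ ‖π‖² ⇒ ‖log_p u‖ ≤ ‖π‖²`** (the Lipschitz range). [cite: NeukirchANT1999, Ch. II (5.5)] -/
theorem norm_unitLog_le_sq (hπ : ‖π‖ ^ p = (p : ℝ)⁻¹) (hfrob : ∀ t : K, ‖t‖ ≤ 1 → ‖t ^ p - t‖ < 1)
    {u : K} (hu : ‖u‖ = 1) (hsmall : ‖u ^ (p - 1) - 1‖ ≤ ‖π‖ ^ 2) : ‖unitLog u‖ ≤ ‖π‖ ^ 2 := by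
  have hsmall' : ‖1 - u ^ (p - 1)‖ ≤ ‖π‖ ^ 2 := by rwa [norm_sub_rev]
  rw [unitLog_eq_c_mul hfrob hu, norm_mul, norm_c_eq_one, one_mul]
  exact (norm_logSeries_le_of_le_sq hπ hsmall').trans hsmall'

/-- Contrapositive: **a unit whose logarithm is a unit has `‖u^{p−1} − 1‖ = ‖π‖`** (it is NOT congruent to a
Teichmüller representative modulo `π²`). [cite: NeukirchANT1999, Ch. II (5.5)] -/
theorem norm_pow_sub_one_eq_of_norm_unitLog_eq_one (hπ : ‖π‖ ^ p = (p : ℝ)⁻¹)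
    (hgap : ∀ x : K, ‖x‖ < 1 → ‖x‖ ≤ ‖π‖) (hfrob : ∀ t : K, ‖t‖ ≤ 1 → ‖t ^ p - t‖ < 1) {u : K}
    (hu : ‖u‖ = 1) (hlog : ‖unitLog u‖ = 1) : ‖u ^ (p - 1) - 1‖ = ‖π‖ := by
  rcases norm_eq_or_le_sq hπ hgap (norm_pow_sub_one_lt_one hfrob hu) with h | h
  · exact h
  · exfalso
    have := (norm_unitLog_le_sq hπ hfrob hu h).trans_lt ((sq_lt_norm_pi hπ).trans (norm_pi_lt_one hπ))
    rw [hlog] at this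
    exact lt_irrefl _ this

/-- **KEY CONGRUENCE `log_p u ≡ c · tᵖ · (πᵖ/p + π) (mod π²)`** for every unit `u`, where
`t := (u^{p−1} − 1)/π` (`‖t‖ ≤ 1`) and `c = (p − 1)⁻¹`: `L(1 + πt) ≡ πt + tᵖ·πᵖ/p` and `πt ≡ πtᵖ`
(Frobenius). [cite: NeukirchANT1999, Ch. II (5.5)] -/
theorem norm_unitLog_sub_main_le_sq (hp2 : p ≠ 2) (hπ : ‖π‖ ^ p = (p : ℝ)⁻¹)
    (hgap : ∀ x : K, ‖x‖ < 1 → ‖x‖ ≤ ‖π‖) (hfrob : ∀ t : K, ‖t‖ ≤ 1 → ‖t ^ p - t‖ < 1) {u : K}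
    (hu : ‖u‖ = 1) :
    ‖unitLog u - (((p - 1 : ℕ) : K))⁻¹ * ((u ^ (p - 1) - 1) / π) ^ p * (π ^ p / (p : K) + π)‖
      ≤ ‖π‖ ^ 2 := by
  have hπ0 : π ≠ 0 := pi_ne_zero hπ
  have hp0 : (p : K) ≠ 0 := prime_ne_zero p K
  have hr0 : 0 < ‖π‖ := norm_pi_pos hπ
  set x : K := u ^ (p - 1) - 1 with hxdef
  set t : K := x / π with htdef
  have hxn : ‖x‖ ≤ ‖π‖ := norm_pow_sub_one_le hgap hfrob hu
  have htn : ‖t‖ ≤ 1 := by rwa [htdef, norm_div, div_le_one hr0]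
  have hxt : x = π * t := by rw [htdef]; field_simp
  -- `L(1 + x) ≡ x + x^p/p`
  have h1 : ‖logSeries (1 + x) - (x + x ^ p / (p : K))‖ ≤ ‖π‖ ^ 2 :=
    norm_logSeries_one_add_sub_le_sq hp2 hπ hxn
  -- `x + x^p/p - t^p (π^p/p + π) = π (t - t^p)`
  have h2 : x + x ^ p / (p : K) - t ^ p * (π ^ p / (p : K) + π) = π * (t - t ^ p) := by
    rw [hxt]; ring
  have h3 : ‖x + x ^ p / (p : K) - t ^ p * (π ^ p / (p : K) + π)‖ ≤ ‖π‖ ^ 2 := by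
    rw [h2, norm_mul, sq, norm_sub_rev]
    exact mul_le_mul_of_nonneg_left (norm_frob_le hgap hfrob htn) hr0.le
  have h4 : ‖logSeries (1 + x) - t ^ p * (π ^ p / (p : K) + π)‖ ≤ ‖π‖ ^ 2 := by
    have : logSeries (1 + x) - t ^ p * (π ^ p / (p : K) + π) =
        (logSeries (1 + x) - (x + x ^ p / (p : K))) + (x + x ^ p / (p : K) - t ^ p * (π ^ p / (p : K) + π)) := by
      ring
    rw [this]
    exact (IsUltrametricDist.norm_add_le_max _ _).trans (max_le h1 h3)
  have hux : u ^ (p - 1) = 1 + x := by rw [hxdef]; ring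
  rw [unitLog_eq_c_mul hfrob hu, hux, mul_assoc, ← mul_sub, norm_mul, norm_c_eq_one, one_mul]
  exact h4

/-- **`‖u^{p−1} − 1‖ = ‖π‖ ⇒ ‖log_p u‖ = 1`** (the main term `c·tᵖ·w` is a unit): the units NOT congruent to
a Teichmüller representative mod `π²` — e.g. `1 + π` — have unit logarithms (DEPTH `2` is inhabited, as
`p ∣ e = p`; cf. abc-iut-w5-d017's criterion). [cite: NeukirchANT1999, Ch. II (5.5)] -/
theorem norm_unitLog_eq_one_of_norm_pow_sub_one_eq (hp2 : p ≠ 2) (hπ : ‖π‖ ^ p = (p : ℝ)⁻¹)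
    (hgap : ∀ x : K, ‖x‖ < 1 → ‖x‖ ≤ ‖π‖) (hfrob : ∀ t : K, ‖t‖ ≤ 1 → ‖t ^ p - t‖ < 1) {u : K}
    (hu : ‖u‖ = 1) (hux : ‖u ^ (p - 1) - 1‖ = ‖π‖) : ‖unitLog u‖ = 1 := by
  have hr0 : 0 < ‖π‖ := norm_pi_pos hπ
  have h := norm_unitLog_sub_main_le_sq hp2 hπ hgap hfrob hu
  set M : K := (((p - 1 : ℕ) : K))⁻¹ * ((u ^ (p - 1) - 1) / π) ^ p * (π ^ p / (p : K) + π) with hM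
  have htn : ‖(u ^ (p - 1) - 1) / π‖ = 1 := by rw [norm_div, hux, div_self hr0.ne']
  have hMn : ‖M‖ = 1 := by
    rw [hM, norm_mul, norm_mul, norm_c_eq_one, norm_pow, htn, one_pow, norm_w_eq_one hπ]; ring
  have hlt : ‖unitLog u - M‖ < ‖M‖ := by
    rw [hMn]; exact h.trans_lt ((sq_lt_norm_pi hπ).trans (norm_pi_lt_one hπ))
  rw [show unitLog u = M + (unitLog u - M) by ring,
    IsUltrametricDist.norm_add_eq_max_of_norm_ne_norm (ne_of_gt hlt), max_eq_left hlt.le, hMn]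


end DepthThree

end Literature.IUT.LogVolume

end
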